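import Summits.Ventures.PercRepro.DecisionTreeHKLower
import Summits.Ventures.PercRepro.DecisionTreeCS

/-!
# Gladkov's Theorem 5.2 for decreasing events

The twin of `DecisionTreeCS.lean` with `B = A ∩ M`, `M` DECREASING: `DTree.cauchy_schwarz_lower`
(`DTree.cs_aux_lower`), the same induction with `DTree.hk_aux_lower` at the leaves.  This is
the form used in Gladkov's Corollary 5.3 (`A = a|b ∪ a|c`, `B = a|b|c` or `a|bc`).
-/

namespace PercRepro

open Finset

variable {E : Type*} [DecidableEq E] [Fintype E]

/-- The decreasing twin of `DTree.cs_aux`: `t₁` an all-`S` tree deciding `A` below the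
queried set `Q`, `t₂` a continuation, the two laws deterministic on `Q` and equal off `Q`,
`B = A ∩ M` with `M` increasing:
`P_{p₁}(B)² ≤ P_{p₁}(A) · E[1_B(ω) · 1_B(ω →_{Q ∪ run t₂ ω ω'} ω')]`. -/
theorem DTree.cs_aux_lower (t₁ : DTree E) : ∀ (t₂ : DTree E) (Q : Finset E) (v : E → Bool)
    (p₁ p₂ : E → ℝ),
    AllS t₁ → Continues t₁ t₂ → Proper t₂ (↑Q) → IsProb p₁ → IsProb p₂ →
    Fixes p₁ (↑Q) v → Det p₂ (↑Q) → (∀ e, e ∉ Q → p₁ e = p₂ e) →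
    ∀ {A M : Set (Config E)}, Decides t₁ (↑Q) v A → IsLowerSet M →
      prob p₁ (A ∩ M) ^ 2 ≤
        prob p₁ A * expectPair p₁ p₂ (fun ω ω' => (A ∩ M).indicator 1 ω *
          (A ∩ M).indicator 1 (mix (↑Q ∪ run t₂ ω ω') ω ω')) := by
  induction t₁ with
  | leaf =>
    intro t₂ Q v p₁ p₂ _ _ ht₂ hp₁ hp₂ hf₁ hd₂ hoff A M hdec hM
    have hd₁ : Det p₁ (↑Q) := hf₁.det
    have hdet : DeterminedOn A (↑Q) v := hdec
    rcases as_const_of_determinedOn hf₁ hdet with hfull | hempty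
    · -- `A` is almost sure: `B` is `M` almost surely, in both copies
      have hA1 : prob p₁ A = 1 := prob_eq_one_of_forall_mem p₁ hfull
      have hB : prob p₁ (A ∩ M) = prob p₁ M :=
        prob_congr_of_support p₁ fun ω hω => ⟨fun h => h.2, fun h => ⟨hfull ω hω, h⟩⟩
      have hE : expectPair p₁ p₂ (fun ω ω' => (A ∩ M).indicator 1 ω *
            (A ∩ M).indicator 1 (mix (↑Q ∪ run t₂ ω ω') ω ω')) =
          expectPair p₁ p₂ (fun ω ω' => M.indicator 1 ω *
            M.indicator 1 (mix (↑Q ∪ run t₂ ω ω') ω ω')) := by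
        refine expectPair_congr fun ω ω' h1 _ => ?_
        have hωA : ω ∈ A := hfull ω h1
        have hΦA : mix (↑Q ∪ run t₂ ω ω') ω ω' ∈ A := by
          refine (hdet ω _ (eq_of_fixes hf₁ h1) fun e he => ?_).mp hωA
          rw [mix_apply_of_mem (Set.mem_union_left _ he)]
          exact eq_of_fixes hf₁ h1 e he
        have e1 : (A ∩ M).indicator (1 : Config E → ℝ) ω = M.indicator 1 ω := by
          by_cases hm : ω ∈ M
          · rw [Set.indicator_of_mem (Set.mem_inter hωA hm), Set.indicator_of_mem hm]
          · rw [Set.indicator_of_notMem fun h => hm h.2, Set.indicator_of_notMem hm]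
        have e2 : (A ∩ M).indicator (1 : Config E → ℝ) (mix (↑Q ∪ run t₂ ω ω') ω ω') =
            M.indicator 1 (mix (↑Q ∪ run t₂ ω ω') ω ω') := by
          by_cases hm : mix (↑Q ∪ run t₂ ω ω') ω ω' ∈ M
          · rw [Set.indicator_of_mem (Set.mem_inter hΦA hm), Set.indicator_of_mem hm]
          · rw [Set.indicator_of_notMem fun h => hm h.2, Set.indicator_of_notMem hm]
        rw [e1, e2]
      have hk := DTree.hk_aux_lower t₂ (↑Q) (↑Q) p₁ p₂ ht₂ hp₁ hp₂ hoff (Set.Subset.refl _) hM hM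
      have hmixdet : expectPair p₁ p₂ (fun ω ω' => M.indicator 1 (mix (↑Q) ω ω')) = prob p₁ M := by
        rw [expectPair_mix_det Q p₁ p₂ hd₁ hd₂ hoff (M.indicator 1), prob_eq_sum_weight_mul_indicator]
      rw [hmixdet] at hk
      rw [hA1, hB, hE, one_mul, sq]
      exact hk
    · -- `A` is almost surely empty: the left-hand side vanishes
      have hB : prob p₁ (A ∩ M) = 0 :=
        prob_eq_zero_of_forall_weight_eq_zero p₁ fun ω hω =>
          by_contra fun h => hempty ω h hω.1
      rw [hB]
      simp only [ne_eq, OfNat.ofNat_ne_zero, not_false_eq_true, zero_pow]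
      refine mul_nonneg (prob_nonneg hp₁ A) (expectPair_nonneg hp₁ hp₂ fun ω ω' => ?_)
      exact mul_nonneg (Set.indicator_nonneg (fun _ _ => zero_le_one) _)
        (Set.indicator_nonneg (fun _ _ => zero_le_one) _)
  | node e toS next₁ ih =>
    intro t₂ Q v p₁ p₂ hall hcont ht₂ hp₁ hp₂ hf₁ hd₂ hoff A M hdec hM
    obtain ⟨htoS, hall'⟩ := hall
    subst htoS
    cases t₂ with
    | leaf => exact absurd hcont id
    | node e' toS' next₂ =>
      obtain ⟨rfl, rfl, hcont'⟩ := hcont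
      obtain ⟨heQ, hnext⟩ := ht₂
      have heQ' : e ∉ Q := fun h => heQ (Finset.mem_coe.mpr h)
      set B := A ∩ M with hBdef
      -- cells
      have hcell : ∀ b b' : Bool,
          prob (upd p₁ e b) B ^ 2 ≤ prob (upd p₁ e b) A *
            expectPair (upd p₁ e b) (upd p₂ e b')
              (fun ω ω' => B.indicator 1 ω *
                B.indicator 1 (mix (↑Q ∪ run (node e true next₂) ω ω') ω ω')) := by
        intro b b'
        have hf₁' : Fixes (upd p₁ e b) (↑(insert e Q)) (Function.update v e b) := by
          intro e' he'
          by_cases h : e' = e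
          · subst h; simp [upd]
          · simp only [upd, Function.update_of_ne h]
            exact hf₁ e' (by simpa [h] using he')
        have hd₂' : Det (upd p₂ e b') (↑(insert e Q)) := by
          intro e' he'
          by_cases h : e' = e
          · subst h; cases b' <;> simp [upd]
          · simp only [upd, Function.update_of_ne h]
            exact hd₂ e' (by simpa [h] using he')
        have hoff' : ∀ e', e' ∉ insert e Q → upd p₁ e b e' = upd p₂ e b' e' := by
          intro e' he'
          have hne : e' ≠ e := fun h => he' (h ▸ Finset.mem_insert_self e Q)
          have he'Q : e' ∉ Q := fun h => he' (Finset.mem_insert_of_mem h)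
          simp only [upd, Function.update_of_ne hne]
          exact hoff e' he'Q
        have hP : Proper (next₂ b b') (↑(insert e Q)) := by
          rw [Finset.coe_insert]; exact hnext b b'
        have hD : Decides (next₁ b b') (↑(insert e Q)) (Function.update v e b) A := by
          rw [Finset.coe_insert]; exact hdec b b'
        have hih := ih b b' (next₂ b b') (insert e Q) (Function.update v e b) (upd p₁ e b)
          (upd p₂ e b') (hall' b b') (hcont' b b') hP (isProb_upd hp₁ e b) (isProb_upd hp₂ e b')
          hf₁' hd₂' hoff' hD hM
        refine hih.trans (le_of_eq ?_)
        congr 1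
        refine expectPair_congr fun ω ω' h1 h2 => ?_
        have hω : ω e = b := eq_of_weight_upd_ne_zero h1
        have hω' : ω' e = b' := eq_of_weight_upd_ne_zero h2
        simp only [run, hω, hω', if_true, Finset.coe_insert, Set.insert_eq, Set.union_assoc]
        rw [Set.union_left_comm]
      -- assemble with the two-point Cauchy–Schwarz inequality
      have hcf : ∀ (p : E → ℝ) (b : Bool), IsProb p → 0 ≤ cf p e b := by
        intro p b hp
        unfold cf
        split_ifs
        · exact hp.nonneg e
        · exact hp.one_sub_nonneg e
      set X : Bool → Bool → ℝ := fun b b' => expectPair (upd p₁ e b) (upd p₂ e b')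
        (fun ω ω' => B.indicator 1 ω *
          B.indicator 1 (mix (↑Q ∪ run (node e true next₂) ω ω') ω ω')) with hX
      set x : Bool → ℝ := fun b => ∑ b' : Bool, cf p₂ e b' * X b b' with hx
      have hux : ∀ b : Bool, prob (upd p₁ e b) B ^ 2 ≤ prob (upd p₁ e b) A * x b := by
        intro b
        have : prob (upd p₁ e b) B ^ 2 = ∑ b' : Bool, cf p₂ e b' * prob (upd p₁ e b) B ^ 2 := by
          rw [← Finset.sum_mul, sum_cf, one_mul]
        rw [this, hx]
        simp only
        rw [Finset.mul_sum]
        refine Finset.sum_le_sum fun b' _ => ?_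
        calc cf p₂ e b' * prob (upd p₁ e b) B ^ 2
            ≤ cf p₂ e b' * (prob (upd p₁ e b) A * X b b') :=
              mul_le_mul_of_nonneg_left (hcell b b') (hcf p₂ b' hp₂)
          _ = prob (upd p₁ e b) A * (cf p₂ e b' * X b b') := by ring
      have hxnn : ∀ b, 0 ≤ x b := by
        intro b
        rw [hx]
        refine Finset.sum_nonneg fun b' _ => mul_nonneg (hcf p₂ b' hp₂) ?_
        exact expectPair_nonneg (isProb_upd hp₁ e b) (isProb_upd hp₂ e b') fun ω ω' =>
          mul_nonneg (Set.indicator_nonneg (fun _ _ => zero_le_one) _)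
            (Set.indicator_nonneg (fun _ _ => zero_le_one) _)
      have hsplitE : expectPair p₁ p₂ (fun ω ω' => B.indicator 1 ω *
            B.indicator 1 (mix (↑Q ∪ run (node e true next₂) ω ω') ω ω')) =
          ∑ b : Bool, cf p₁ e b * x b := by
        rw [expectPair_split p₁ p₂ e, hx]
        simp only
        refine Finset.sum_congr rfl fun b _ => ?_
        rw [Finset.mul_sum]
        refine Finset.sum_congr rfl fun b' _ => ?_
        rw [hX]; ring
      rw [hsplitE, prob_eq_sum_cf p₁ e B, prob_eq_sum_cf p₁ e A]
      simp only [Fintype.sum_bool]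
      exact cauchy_schwarz_two_point (hcf p₁ true hp₁) (hcf p₁ false hp₁)
        (prob_nonneg (isProb_upd hp₁ e true) A) (prob_nonneg (isProb_upd hp₁ e false) A)
        (hxnn true) (hxnn false) (hux true) (hux false)

/-- **Gladkov's Theorem 5.2, decreasing case**: for an all-`S` decision tree `t₁` deciding `A`,
a continuation `t₂` (proper), and `B = A ∩ M` with `M` decreasing,
`P(B)² ≤ P(A) · P(ω ∈ B ∧ ω →_{run t₂ ω ω'} ω' ∈ B)`. -/
theorem DTree.cauchy_schwarz_lower {p : E → ℝ} (hp : IsProb p) {t₁ t₂ : DTree E} (h₁ : AllS t₁)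
    (hc : Continues t₁ t₂) (ht₂ : Proper t₂ ∅) {A M : Set (Config E)}
    (hdec : Decides t₁ ∅ (fun _ => false) A) (hM : IsLowerSet M) :
    prob p (A ∩ M) ^ 2 ≤
      prob p A * ∑ ω, ∑ ω', weight p ω * weight p ω' *
        ((A ∩ M).indicator 1 ω * (A ∩ M).indicator 1 (mix (run t₂ ω ω') ω ω')) := by
  have h := DTree.cs_aux_lower t₁ t₂ ∅ (fun _ => false) p p h₁ hc (by simpa using ht₂) hp hp
    (fun e he => absurd he (by simp)) (fun e he => absurd he (by simp)) (fun _ _ => rfl)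
    (by simpa using hdec) hM
  simpa [expectPair] using h

end PercRepro
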